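import Summits.BirchSwinnertonDyer.BirchSwinnertonDyer.Theorems.EisensteinPrimesBSDpOnCellCOfCitedFactsV17
import Summits.BirchSwinnertonDyer.BirchSwinnertonDyer.Theorems.EisensteinPrimesBSDpOnCellCTelescopeBranchGaloisLatticeOfUntwistedFact
import HarnessLib

/-!
# [telescope v18 — successor LEAD cruxlead-19034 g5, 2026-08-30] CRUX 4 `BSDpOnCellC` FROM THE RE-SOURCED CITED FACT T-An-2ᴴ AND CRUX 3 — CONDITIONAL CLOSURE, SORRY-FREE (sibling of p769883)
# Crux 4 `BSDpOnCellC` (stmt-BirchSwinnertonDyer-19034), line «telescope» v18 (`--supports`, helper; CONDITIONAL — closes nothing)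

WHAT: `bsdpOnCellC_of_citedFactsH (hPub) (hPre) (hGal) (hMazur) : …Theses.EisensteinPrimes.BSDpOnCellC` with `hPub`/`hPre`/`hMazur` the texts of v17/v18's `stub_publishedFacts`
(23 refereed named facts) / `stub_preprintFacts` (Keller–Yin 2024 ×4) / `stub_mazurMC_cellB` (crux 3) token for token, and `hGal` = the v18 assembled cite stub's fact T-An-2ᴴ
`Literature.NumberTheory.EllipticCurves.hida1986_castella2020_exists_untwistedGaloisLattice_on_pNewBranchChart` (ideator bsd-idea-12 g42, p774987: Hida 1986 Thm. 2.1 (2.2b)(2.2c) read print-verbatim on the analytic chart,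
untwisted, conjugacy over `Ω`). PROOF = ONE LINE: the v17 closure `EisensteinPrimesBSDpOnCellCOfCitedFactsV17.bsdpOnCellC_of_citedFacts` (LEAD g5 p769883) with `hGal` transported along
the LANDED bridge `TelescopeBranchGaloisLatticeOfUntwistedFact.galoisLattice_of_untwistedGaloisLattice : T-An-2ᴴ → T-An-2ᵍ` (x2-p2 g24 #6; x2-p2 g24's descent / twist / remainder theorems composed).

HONEST FRAMING: CONDITIONAL result (the gate records it as such); it discharges none of its four hypotheses; closes no registered stub, no crux, no summit statement; BSD is proved
for no curve by this file. THEOREMS ONLY: no definition, no named fact, no instance, no `sorry`.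
References (shape only): [cite: Hida1986, Thm. 2.1 (2.2b) (2.2c)] [cite: KellerYin2024, Thm. 3.0.8, Thm. 2.2.2 (arXiv:2402.12781v2)] [cite: GreenbergVatsal2000, Thm. (1.3)]
-/

set_option autoImplicit false
set_option linter.dupNamespace false

noncomputable section

open scoped Classical MatrixGroups ModularForm

open CongruenceSubgroup WeierstrassCurve NumberField IsDedekindDomain Field PowerSeries
  Literature.NumberTheory.EllipticCurves Literature.NumberTheory.EllipticCurves.GreenbergSelmer
  Literature.NumberTheory.EllipticCurves.ModularForms Literature.NumberTheory.QuadraticFields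
  Literature.NumberTheory.EllipticCurves.Rank1Residual
  Literature.NumberTheory.EllipticCurves.Rank1Residual.Typed
  Literature.NumberTheory.EllipticCurves.KrizLi2019
  Literature.NumberTheory.EllipticCurves.GreenbergVatsal2000
  Literature.NumberTheory.EllipticCurves.Wuthrich2014
  Literature.NumberTheory.EllipticCurves.SteinWuthrich2013
  Literature.NumberTheory.EllipticCurves.Castella2018Exceptional
  Literature.NumberTheory.GaloisRepresentations Literature.NumberTheory.GaloisCohomology
  Literature.NumberTheory.Automorphic
  Summit.BirchSwinnertonDyer.Rank1Residual.X11b.AcSelmer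
  Summit.BirchSwinnertonDyer.Rank1Residual.X11b.Halves
  Summit.BirchSwinnertonDyer.Rank1Residual.X11b
  Summit.BirchSwinnertonDyer.Rank1Residual Summit.BirchSwinnertonDyer.Rank1Residual.X1
  Summit.BirchSwinnertonDyer.Rank1Residual.X2
open Literature.NumberTheory.EllipticCurves.KellerYin2024 (curveLocalLambda)


open Literature.NumberTheory.EllipticCurves.BigGaloisRep


namespace Summit.BirchSwinnertonDyer.BirchSwinnertonDyer.Theorems.EisensteinPrimesBSDpOnCellCOfCitedFactsV18

open Literature.NumberTheory.EllipticCurves.CastellaGrossiLeeSkinner2022 Literature.NumberTheory.EllipticCurves.Castella2018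
  Literature.NumberTheory.IwasawaTheory Literature.NumberTheory.IwasawaTheory.Greenberg2016
  Literature.NumberTheory.IwasawaTheory.Greenberg2006
  Summit.BirchSwinnertonDyer.Rank1Residual.X1.KellerYinMuLambdaSplit
open Literature.NumberTheory.EllipticCurves.KellerYin2024
open Summit.BirchSwinnertonDyer.BirchSwinnertonDyer.Theorems

/-- **Crux 4 `BSDpOnCellC` from the re-sourced cited fact T-An-2ᴴ, the other cited facts and crux 3 (telescope v18, conditional closure).** Hypotheses = the texts of v18's
four registered stubs token for token; proof = the v17 closure along the landed bridge T-An-2ᴴ → T-An-2ᵍ. CONDITIONAL: nothing here discharges the hypotheses.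
[cite: Hida1986, Thm. 2.1 (2.2b) (2.2c) (shape only)] [cite: KellerYin2024, Thm. 3.0.8 (shape only)] [cite: GreenbergVatsal2000, Thm. (1.3) (shape only)] -/
theorem bsdpOnCellC_of_citedFactsH
    (hPub :
    ((((lambdaMu_multiplicative_of_gvPar ∧ thm16_charIdeal_dvd_multiplicative_of_reducible ∧
    thm61_splitMultiplicative ∧ thm61_nonsplitMultiplicative ∧
    (∀ (W : WeierstrassCurve ℚ) [W.IsElliptic] [W.IsGloballyMinimal] (p : ℕ) [Fact p.Prime],
      greenberg_stevens (W := W) (p := p)) ∧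
    exists_isNewformOf ∧
    hsieh2014_exists_anticyclotomicPAdicLFunction ∧
    (∀ (N : ℕ) [NeZero N] (W : WeierstrassCurve ℚ) (K : Type) [Field K] [NumberField K],
      gross_zagier N W K) ∧
    (∀ (N : ℕ) [NeZero N] (W : WeierstrassCurve ℚ) (K : Type) [Field K] [NumberField K],
      kolyvagin N W K) ∧
    rank_eq_analyticRank_of_analyticRank_le_one ∧ HoffsteinLuo1997_exists_twist_L_one_ne_zero ∧
    mazur_not_dvd_maninConstant_of_odd ∧ bsdRHS_eq_of_isIsogenous) ∧
    thm210_thm211_bdpDisplay_pNew) ∧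
    LiuZhangZhang2018.thm151_thm153_modularCurve_heegnerVector) ∧
    (prop125_characterGrSelmerDual_torsion_muZero_dim ∧
      cor126_residualCharacter_globalLift ∧ cor126_residualCharacter_localSurjective ∧
      thm212_exists_isKatzLFunction ∧
      Literature.NumberTheory.EllipticCurves.Castella2018.cas20_thm211_memberForms_sigmaFrames_congr)) ∧
      Literature.NumberTheory.EllipticCurves.BCGKPST2020.thm331_rubin_exists_katzMeasure₂_pseudoIso_span_eq ∧
      Literature.NumberTheory.EllipticCurves.DeShalit1987.thmII64_katzMeasure₂_functionalEquation ∧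
      Literature.NumberTheory.EllipticCurves.Hida2010MuInvariant.thmI_mu_katzBranch_reflect_eq_zero)
    (hPre :
    Literature.NumberTheory.EllipticCurves.KellerYin2024.thm308_imc2_hidaMember_dvd_OPEN ∧
      Literature.NumberTheory.EllipticCurves.KellerYin2024.thm222_anacong_hidaMember_sigma_mu_OPEN ∧
      Literature.NumberTheory.EllipticCurves.KellerYin2024.thm222_anacong_hidaMember_sigma_lambda_OPEN ∧
      Literature.NumberTheory.EllipticCurves.KellerYin2024.thm308_imc2_hidaMember_isTorsion_OPEN)
    (hGal : Literature.NumberTheory.EllipticCurves.hida1986_castella2020_exists_untwistedGaloisLattice_on_pNewBranchChart)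
    (hMazur :
    Summit.BirchSwinnertonDyer.BirchSwinnertonDyer.Theses.EisensteinPrimes.MazurMCOnCellB) :
    Summit.BirchSwinnertonDyer.BirchSwinnertonDyer.Theses.EisensteinPrimes.BSDpOnCellC :=
  EisensteinPrimesBSDpOnCellCOfCitedFactsV17.bsdpOnCellC_of_citedFacts hPub hPre
    (Summit.BirchSwinnertonDyer.BirchSwinnertonDyer.Theorems.TelescopeBranchGaloisLatticeOfUntwistedFact.galoisLattice_of_untwistedGaloisLattice hGal) hMazur

end Summit.BirchSwinnertonDyer.BirchSwinnertonDyer.Theorems.EisensteinPrimesBSDpOnCellCOfCitedFactsV18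

end
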